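import Literature.NumberTheory.Sieve.PolymathSieveAsymptoticsProofs
import HarnessLib

/-!
# Cell averages and the averaged quasi-interpolant (tooling for Theorem 3.14, §5.4)

Trunk AntSieve, tooling toward the named fact `Literature.NumberTheory.Sieve.weakDHL_three_two_of_GEH`
(D. H. J. Polymath, Res. Math. Sci. 1:12 (2014) = arXiv:1407.4897, Theorem 3.2(xii)).

In the proof of Theorem 3.14 (§5.4, p. 23) the test function `F` (supported on `(k/(k-1))·R_k`,
with vanishing `t_i`-marginals beyond `Σ_{j ≠ i} t_j > 1 + ε`) is approximated by tensor products of
one-variable cutoffs.  The tree's §5.3 construction (`PolymathSieveAsymptoticsProofs.lean`) samples a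
continuous approximant at the grid points `δl`; for §5.4 we need the approximation to inherit the
vanishing marginals EXACTLY along grid rows, so we use instead the averages of `F` itself over the
grid cells `Q_l = ∏_i [δ(l_i - 1), δ l_i)`:

* `avgCell δ l`, `cellAvg δ F l = δ^{-k} ∫_{Q_l} F`; cells are disjoint, of volume `δ^k`, and
  `cellAvg` vanishes unless `Q_l` meets the support of `F`;
* `sq_cellAvg_le` (Jensen on a cell) and `integral_sq_tensorSum_cellAvg_le`: the averaged
  quasi-interpolant `A_δ h = Σ_l (cellAvg δ h l) ∏_i ζ(x_i/δ - l_i)` satisfies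
  `∫_{box} (A_δ h)² ≤ 2^k ∫ h²` (pointwise Cauchy–Schwarz against the partition of unity, then
  disjointness of the cells);
* `abs_tensorSum_cellAvg_sub_le`: `|A_δ Φ(x) - Φ(x)| ≤ ω` on the box when `Φ` has modulus of
  continuity `ω` at scale `2δ`;
* `sum_cellAvg_row_eq_zero`: the ROW SUMS `Σ_m cellAvg δ F (l with l_{i₀} := m)` vanish when the
  reduced cell `Q'_l` lies in the region where the `t_{i₀}`-marginal of `F` vanishes almost
  everywhere (Fubini along `i₀`).

## References

* [Polymath8b2014] D. H. J. Polymath, Res. Math. Sci. 1 (2014), Art. 12 = arXiv:1407.4897,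
  Theorem 3.14, §5.4 (p. 23).
-/

noncomputable section

open MeasureTheory Filter Finset Real
open scoped BigOperators Topology

namespace Literature.NumberTheory.Sieve

/-! ### Cells and cell averages -/

section Cells

variable {k : ℕ}

/-- The grid cell `Q_l = ∏_i [δ(l_i - 1), δ l_i)` attached to the multi-index `l`. [cite: Polymath8b2014, Theorem 3.14 (proof, §5.4, p. 23)] -/
def avgCell (δ : ℝ) (l : Fin k → ℤ) : Set (Fin k → ℝ) :=
  Set.pi Set.univ fun i => Set.Ico (δ * ((l i : ℝ) - 1)) (δ * (l i : ℝ))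

/-- The cell average `δ^{-k} ∫_{Q_l} F`. [cite: Polymath8b2014, Theorem 3.14 (proof, §5.4, p. 23)] -/
def cellAvg (δ : ℝ) (F : (Fin k → ℝ) → ℝ) (l : Fin k → ℤ) : ℝ :=
  (δ ^ k)⁻¹ * ∫ y in avgCell δ l, F y

/-- Cells are measurable. [folklore] -/
theorem measurableSet_avgCell (δ : ℝ) (l : Fin k → ℤ) : MeasurableSet (avgCell δ l) :=
  MeasurableSet.univ_pi fun _ => measurableSet_Ico

/-- Coordinates of a point of `Q_l`. [folklore] -/
theorem mem_avgCell_iff {δ : ℝ} {l : Fin k → ℤ} {y : Fin k → ℝ} :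
    y ∈ avgCell δ l ↔ ∀ i, δ * ((l i : ℝ) - 1) ≤ y i ∧ y i < δ * (l i : ℝ) := by
  simp [avgCell]

/-- The volume of a cell is `δ^k`. [folklore] -/
theorem volume_avgCell_toReal {δ : ℝ} (hδ : 0 ≤ δ) (l : Fin k → ℤ) :
    (volume (avgCell δ l)).toReal = δ ^ k := by
  unfold avgCell
  rw [Real.volume_pi_Ico_toReal]
  · rw [Finset.prod_congr rfl fun i _ => show δ * (l i : ℝ) - δ * ((l i : ℝ) - 1) = δ by ring,
      Finset.prod_const, Finset.card_univ, Fintype.card_fin]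
  · intro i
    show δ * ((l i : ℝ) - 1) ≤ δ * (l i : ℝ)
    nlinarith

/-- The volume of a cell, `ℝ≥0∞` form. [folklore] -/
theorem volume_avgCell {δ : ℝ} (hδ : 0 ≤ δ) (l : Fin k → ℤ) :
    volume (avgCell δ l) = ENNReal.ofReal (δ ^ k) := by
  rw [← volume_avgCell_toReal hδ l, ENNReal.ofReal_toReal]
  unfold avgCell
  rw [Real.volume_pi_Ico]
  exact ENNReal.prod_ne_top fun _ _ => ENNReal.ofReal_ne_top

/-- Cells have finite volume. [folklore] -/
theorem volume_avgCell_lt_top {δ : ℝ} (hδ : 0 ≤ δ) (l : Fin k → ℤ) :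
    volume (avgCell δ l) < ⊤ := by
  rw [volume_avgCell hδ]
  exact ENNReal.ofReal_lt_top

/-- `μ.real` of a cell. [folklore] -/
theorem measureReal_avgCell {δ : ℝ} (hδ : 0 ≤ δ) (l : Fin k → ℤ) :
    volume.real (avgCell δ l) = δ ^ k := by
  rw [measureReal_def, volume_avgCell_toReal hδ]

/-- A cell is contained in a closed box. [folklore] -/
theorem avgCell_subset_Icc (δ : ℝ) (l : Fin k → ℤ) :
    avgCell δ l ⊆ Set.Icc (fun i => δ * ((l i : ℝ) - 1)) (fun i => δ * (l i : ℝ)) := by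
  intro y hy
  rw [mem_avgCell_iff] at hy
  exact ⟨fun i => (hy i).1, fun i => (hy i).2.le⟩

/-- Distinct multi-indices give disjoint cells. [folklore] -/
theorem disjoint_avgCell {δ : ℝ} (hδ : 0 < δ) {l l' : Fin k → ℤ} (h : l ≠ l') :
    Disjoint (avgCell δ l) (avgCell δ l') := by
  obtain ⟨i, hi⟩ : ∃ i, l i ≠ l' i := by
    by_contra hall
    push Not at hall
    exact h (funext hall)
  rw [Set.disjoint_left]
  intro y hy hy'
  rw [mem_avgCell_iff] at hy hy'
  obtain ⟨h1, h2⟩ := hy i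
  obtain ⟨h1', h2'⟩ := hy' i
  rcases lt_or_gt_of_ne hi with hlt | hlt
  · have : (l i : ℝ) ≤ (l' i : ℝ) - 1 := by exact_mod_cast Int.le_sub_one_of_lt hlt
    nlinarith
  · have : (l' i : ℝ) ≤ (l i : ℝ) - 1 := by exact_mod_cast Int.le_sub_one_of_lt hlt
    nlinarith

/-- A bounded function has bounded cell averages. [folklore] -/
theorem abs_cellAvg_le {δ : ℝ} (hδ : 0 < δ) {F : (Fin k → ℝ) → ℝ} {C : ℝ}
    (hC : ∀ y, |F y| ≤ C) (l : Fin k → ℤ) : |cellAvg δ F l| ≤ C := by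
  have hvol := volume_avgCell_lt_top hδ.le l
  have h := norm_setIntegral_le_of_norm_le_const hvol (f := F) fun y _ => by
    rw [Real.norm_eq_abs]; exact hC y
  rw [measureReal_avgCell hδ.le, Real.norm_eq_abs] at h
  have hδk : 0 < δ ^ k := pow_pos hδ k
  rw [cellAvg, abs_mul, abs_inv, abs_of_pos hδk]
  calc (δ ^ k)⁻¹ * |∫ y in avgCell δ l, F y| ≤ (δ ^ k)⁻¹ * (C * δ ^ k) :=
        mul_le_mul_of_nonneg_left h (inv_nonneg.2 hδk.le)
    _ = C := by field_simp

/-- The cell average vanishes when `F` vanishes on the cell. [folklore] -/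
theorem cellAvg_eq_zero_of_forall {δ : ℝ} {F : (Fin k → ℝ) → ℝ} {l : Fin k → ℤ}
    (h : ∀ y ∈ avgCell δ l, F y = 0) : cellAvg δ F l = 0 := by
  rw [cellAvg, setIntegral_congr_fun (measurableSet_avgCell δ l) h]
  simp

/-- If a cell average is non-zero, the cell contains a point where `F ≠ 0`. [folklore] -/
theorem exists_mem_of_cellAvg_ne_zero {δ : ℝ} {F : (Fin k → ℝ) → ℝ} {l : Fin k → ℤ}
    (h : cellAvg δ F l ≠ 0) : ∃ y ∈ avgCell δ l, F y ≠ 0 := by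
  by_contra hno
  push Not at hno
  exact h (cellAvg_eq_zero_of_forall hno)

/-- Cell averages are additive in `F` (for functions integrable on the cell). [folklore] -/
theorem cellAvg_sub {δ : ℝ} {F G : (Fin k → ℝ) → ℝ} {l : Fin k → ℤ}
    (hF : IntegrableOn F (avgCell δ l)) (hG : IntegrableOn G (avgCell δ l)) :
    cellAvg δ (fun y => F y - G y) l = cellAvg δ F l - cellAvg δ G l := by
  simp only [cellAvg]
  rw [integral_sub hF hG, mul_sub]

/-- **Jensen on a cell**: `(cellAvg δ h l)² ≤ δ^{-k} ∫_{Q_l} h²`. [folklore] -/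
theorem sq_cellAvg_le {δ : ℝ} (hδ : 0 < δ) {h : (Fin k → ℝ) → ℝ} {l : Fin k → ℤ}
    (h1 : IntegrableOn h (avgCell δ l)) (h2 : IntegrableOn (fun y => h y ^ 2) (avgCell δ l)) :
    cellAvg δ h l ^ 2 ≤ (δ ^ k)⁻¹ * ∫ y in avgCell δ l, h y ^ 2 := by
  have hδk : 0 < δ ^ k := pow_pos hδ k
  have hvol : volume (avgCell δ l) = ENNReal.ofReal (δ ^ k) := volume_avgCell hδ.le l
  have h0 : volume (avgCell δ l) ≠ 0 := by rw [hvol]; exact (ENNReal.ofReal_pos.2 hδk).ne'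
  have htop : volume (avgCell δ l) ≠ ⊤ := by rw [hvol]; exact ENNReal.ofReal_ne_top
  have hJ := ConvexOn.map_set_average_le (Even.convexOn_pow (n := 2) even_two)
    (continuous_pow 2).continuousOn isClosed_univ h0 htop (ae_of_all _ fun u => Set.mem_univ _)
    h1 h2
  rw [setAverage_eq, setAverage_eq, smul_eq_mul, smul_eq_mul, measureReal_avgCell hδ.le] at hJ
  exact hJ

end Cells

/-! ### The averaged quasi-interpolant: `L²` bound -/

section L2Bound

variable {k : ℕ}

/-- A tensor bump is at most `1`. [folklore] -/
theorem tensorBump_le_one (δ : ℝ) (l : Fin k → ℤ) (x : Fin k → ℝ) : tensorBump δ l x ≤ 1 :=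
  Finset.prod_le_one (fun _ _ => pouBump_nonneg _) fun _ _ => pouBump_le_one _

/-- A tensor bump vanishes off the cube `∏_i [δ(l_i - 1), δ(l_i + 1)]`. [folklore] -/
theorem tensorBump_eq_zero_of_not_mem {δ : ℝ} (hδ : 0 < δ) {l : Fin k → ℤ} {x : Fin k → ℝ}
    (hx : x ∉ Set.Icc (fun i => δ * ((l i : ℝ) - 1)) (fun i => δ * ((l i : ℝ) + 1))) :
    tensorBump δ l x = 0 := by
  have : ∃ i, x i < δ * ((l i : ℝ) - 1) ∨ δ * ((l i : ℝ) + 1) < x i := by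
    by_contra hall
    push Not at hall
    exact hx ⟨fun i => (hall i).1, fun i => (hall i).2⟩
  obtain ⟨i, hi⟩ := this
  refine tensorBump_eq_zero (i := i) ?_
  rcases hi with hi | hi
  · have : x i / δ - l i ≤ -1 := by
      rw [sub_le_iff_le_add, div_le_iff₀ hδ]; linarith
    rw [le_abs]; right; linarith
  · have : 1 ≤ x i / δ - l i := by
      rw [le_sub_iff_add_le, le_div_iff₀ hδ]; linarith
    exact le_abs.2 (Or.inl this)

/-- Tensor bumps are measurable. [folklore] -/
theorem measurable_tensorBump (δ : ℝ) (l : Fin k → ℤ) : Measurable (tensorBump δ l) :=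
  (tensorBump_continuous δ l).measurable

/-- `∫ ∏_i ζ(x_i/δ - l_i) dx ≤ (2δ)^k`: the bump is at most the indicator of its cube. [folklore] -/
theorem integral_tensorBump_le {δ : ℝ} (hδ : 0 < δ) (l : Fin k → ℤ) :
    ∫ x, tensorBump δ l x ≤ (2 * δ) ^ k := by
  set B : Set (Fin k → ℝ) := Set.Icc (fun i => δ * ((l i : ℝ) - 1)) (fun i => δ * ((l i : ℝ) + 1))
    with hB
  have hvol : (volume B).toReal = (2 * δ) ^ k := by
    rw [hB, Real.volume_Icc_pi_toReal]
    · rw [Finset.prod_congr rfl fun i _ =>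
          show δ * ((l i : ℝ) + 1) - δ * ((l i : ℝ) - 1) = 2 * δ by ring,
        Finset.prod_const, Finset.card_univ, Fintype.card_fin]
    · intro i
      show δ * ((l i : ℝ) - 1) ≤ δ * ((l i : ℝ) + 1)
      nlinarith
  have hind : ∀ x, tensorBump δ l x ≤ B.indicator (fun _ => (1 : ℝ)) x := fun x => by
    by_cases hx : x ∈ B
    · rw [Set.indicator_of_mem hx]; exact tensorBump_le_one δ l x
    · rw [Set.indicator_of_notMem hx, tensorBump_eq_zero_of_not_mem hδ hx]
  have hBm : MeasurableSet B := measurableSet_Icc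
  have hBvol : volume B < ⊤ := by rw [hB]; exact measure_Icc_lt_top
  have hint : Integrable (B.indicator fun _ => (1 : ℝ)) :=
    (integrable_indicator_iff hBm).2 (integrableOn_const hBvol.ne)
  by_cases hi : Integrable (tensorBump δ l)
  · calc ∫ x, tensorBump δ l x ≤ ∫ x, B.indicator (fun _ => (1 : ℝ)) x :=
          integral_mono hi hint hind
      _ = (2 * δ) ^ k := by
          rw [integral_indicator hBm, setIntegral_const, smul_eq_mul, mul_one, measureReal_def, hvol]
  · rw [integral_undef hi]; positivity

/-- Pointwise Cauchy–Schwarz against the partition of unity: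
`(Σ_l a_l T_l(x))² ≤ Σ_l a_l² T_l(x)` whenever `Σ_l T_l(x) ≤ 1`. [folklore] -/
theorem sq_tensorSum_le {δ : ℝ} {L : ℕ} {J : Finset (Fin k → ℤ)} (hJ : J ⊆ indexBox k L)
    (a : (Fin k → ℤ) → ℝ) {x : Fin k → ℝ} (hx : ∀ i, -(L : ℝ) ≤ x i / δ ∧ x i / δ ≤ L) :
    tensorSum δ J a x ^ 2 ≤ ∑ l ∈ J, a l ^ 2 * tensorBump δ l x := by
  have h1 : ∑ l ∈ J, tensorBump δ l x ≤ 1 := sum_tensorBump_le_one hJ hx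
  have hcs := sum_sq_le_sum_mul_sum_of_sq_le_mul J (r := fun l => a l * tensorBump δ l x)
    (f := fun l => tensorBump δ l x) (g := fun l => a l ^ 2 * tensorBump δ l x)
    (fun l _ => tensorBump_nonneg δ l x)
    (fun l _ => mul_nonneg (sq_nonneg _) (tensorBump_nonneg δ l x))
    (fun l _ => by ring_nf; rfl)
  have hg0 : 0 ≤ ∑ l ∈ J, a l ^ 2 * tensorBump δ l x :=
    Finset.sum_nonneg fun l _ => mul_nonneg (sq_nonneg _) (tensorBump_nonneg δ l x)
  unfold tensorSum
  calc (∑ l ∈ J, a l * tensorBump δ l x) ^ 2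
      ≤ (∑ l ∈ J, tensorBump δ l x) * ∑ l ∈ J, a l ^ 2 * tensorBump δ l x := hcs
    _ ≤ 1 * ∑ l ∈ J, a l ^ 2 * tensorBump δ l x := mul_le_mul_of_nonneg_right h1 hg0
    _ = _ := one_mul _

/-- **`L²` bound for the averaged quasi-interpolant**: for `h` with `h²` integrable,
`∫_{(0,R]^k} (Σ_{l ∈ J} (cellAvg δ h l) T_l)² ≤ 2^k ∫ h²` (`J ⊆ box`, `R ≤ δL`). [cite: Polymath8b2014, Theorem 3.14 (proof, §5.4, p. 23)] -/
theorem integral_sq_tensorSum_cellAvg_le {δ : ℝ} (hδ : 0 < δ) {L : ℕ} {J : Finset (Fin k → ℤ)}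
    (hJ : J ⊆ indexBox k L) {R : ℝ} (hRL : R / δ ≤ L) {h : (Fin k → ℝ) → ℝ}
    (hm : AEStronglyMeasurable h volume) (h2 : Integrable fun y => h y ^ 2) :
    ∫ x in ioBox k R, tensorSum δ J (cellAvg δ h) x ^ 2 ≤ 2 ^ k * ∫ y, h y ^ 2 := by
  classical
  -- integrability of `h` and `h²` on cells
  have h2cell : ∀ l, IntegrableOn (fun y => h y ^ 2) (avgCell δ l) := fun l => h2.integrableOn
  have h1cell : ∀ l, IntegrableOn h (avgCell δ l) := by
    intro l
    have hmem : MemLp h 2 (volume.restrict (avgCell δ l)) :=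
      (memLp_two_iff_integrable_sq hm.restrict).2 (h2cell l)
    haveI : IsFiniteMeasure (volume.restrict (avgCell δ l)) :=
      isFiniteMeasure_restrict.2 (volume_avgCell_lt_top hδ.le l).ne
    exact hmem.integrable one_le_two
  -- Step 1: pointwise bound on the box
  have hbox : ∀ x ∈ ioBox k R, ∀ i, -(L : ℝ) ≤ x i / δ ∧ x i / δ ≤ L := by
    intro x hx i
    rw [ioBox, Set.mem_univ_pi] at hx
    constructor
    · have : 0 ≤ x i / δ := div_nonneg (hx i).1.le hδ.le
      linarith [(Nat.cast_nonneg L : (0 : ℝ) ≤ L)]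
    · exact (div_le_div_of_nonneg_right (hx i).2 hδ.le).trans hRL
  have hcontS : Continuous fun x => tensorSum δ J (cellAvg δ h) x ^ 2 :=
    (tensorSum_continuous δ J _).pow 2
  have hint1 : IntegrableOn (fun x => tensorSum δ J (cellAvg δ h) x ^ 2) (ioBox k R) :=
    integrableOn_ioBox_of_continuous hcontS R
  have hbumpint : ∀ l : Fin k → ℤ, Integrable (tensorBump δ l) := fun l =>
    (tensorBump_continuous δ l).integrable_of_hasCompactSupport
      (HasCompactSupport.of_support_subset_isCompact (isCompact_Icc
        (a := fun i => δ * ((l i : ℝ) - 1)) (b := fun i => δ * ((l i : ℝ) + 1))) fun x hx => by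
          by_contra hxB
          exact hx (tensorBump_eq_zero_of_not_mem hδ hxB))
  have hint2 : ∀ l, Integrable fun x => cellAvg δ h l ^ 2 * tensorBump δ l x := fun l =>
    (hbumpint l).const_mul _
  have hint2' : IntegrableOn (fun x => ∑ l ∈ J, cellAvg δ h l ^ 2 * tensorBump δ l x) (ioBox k R) :=
    (integrable_finsetSum _ fun l _ => hint2 l).integrableOn
  have step1 : ∫ x in ioBox k R, tensorSum δ J (cellAvg δ h) x ^ 2 ≤
      ∫ x in ioBox k R, ∑ l ∈ J, cellAvg δ h l ^ 2 * tensorBump δ l x :=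
    setIntegral_mono_on hint1 hint2' (measurableSet_ioBox R) fun x hx =>
      sq_tensorSum_le hJ _ (hbox x hx)
  -- Step 2: integrate the bumps
  have step2 : ∫ x in ioBox k R, ∑ l ∈ J, cellAvg δ h l ^ 2 * tensorBump δ l x ≤
      ∑ l ∈ J, cellAvg δ h l ^ 2 * (2 * δ) ^ k := by
    rw [integral_finsetSum _ fun l _ => (hint2 l).integrableOn]
    refine Finset.sum_le_sum fun l _ => ?_
    rw [integral_const_mul]
    refine mul_le_mul_of_nonneg_left ?_ (sq_nonneg _)
    calc ∫ x in ioBox k R, tensorBump δ l x ≤ ∫ x, tensorBump δ l x :=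
          setIntegral_le_integral (hbumpint l) (ae_of_all _ fun x => tensorBump_nonneg δ l x)
      _ ≤ (2 * δ) ^ k := integral_tensorBump_le hδ l
  -- Step 3: Jensen on each cell and disjointness
  have step3 : ∑ l ∈ J, cellAvg δ h l ^ 2 * (2 * δ) ^ k ≤ 2 ^ k * ∫ y, h y ^ 2 := by
    have hδk : 0 < δ ^ k := pow_pos hδ k
    calc ∑ l ∈ J, cellAvg δ h l ^ 2 * (2 * δ) ^ k
        ≤ ∑ l ∈ J, ((δ ^ k)⁻¹ * ∫ y in avgCell δ l, h y ^ 2) * (2 * δ) ^ k :=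
          Finset.sum_le_sum fun l _ => mul_le_mul_of_nonneg_right
            (sq_cellAvg_le hδ (h1cell l) (h2cell l)) (by positivity)
      _ = 2 ^ k * ∑ l ∈ J, ∫ y in avgCell δ l, h y ^ 2 := by
          rw [Finset.mul_sum]
          refine Finset.sum_congr rfl fun l _ => ?_
          rw [mul_pow]
          field_simp
      _ = 2 ^ k * ∫ y in ⋃ l ∈ J, avgCell δ l, h y ^ 2 := by
          rw [integral_biUnion_finset J (fun l _ => measurableSet_avgCell δ l) ?_
            (fun l _ => h2cell l)]
          intro l _ l' _ hll'
          exact disjoint_avgCell hδ hll'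
      _ ≤ 2 ^ k * ∫ y, h y ^ 2 := by
          refine mul_le_mul_of_nonneg_left ?_ (by positivity)
          exact setIntegral_le_integral h2 (ae_of_all _ fun y => sq_nonneg _)
  exact step1.trans (step2.trans step3)

end L2Bound

/-! ### The averaged quasi-interpolant: uniform approximation of continuous functions -/

section Uniform

variable {k : ℕ}

/-- **Uniform error of the averaged quasi-interpolant** inside the box: if `|Φ(y) - Φ(x)| ≤ ω`
whenever `|y_i - x_i| ≤ 2δ` for all `i`, then `|Σ_{l ∈ box} (cellAvg δ Φ l) T_l(x) - Φ(x)| ≤ ω`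
(`Φ` continuous). [cite: Polymath8b2014, Theorem 3.14 (proof, §5.4, p. 23)] -/
theorem abs_tensorSum_cellAvg_sub_le {δ : ℝ} (hδ : 0 < δ) {L : ℕ} {Φ : (Fin k → ℝ) → ℝ}
    (hΦ : Continuous Φ) {x : Fin k → ℝ} (hx : ∀ i, -(L : ℝ) ≤ x i / δ ∧ x i / δ ≤ L) {w : ℝ}
    (hω : ∀ y : Fin k → ℝ, (∀ i, |y i - x i| ≤ 2 * δ) → |Φ y - Φ x| ≤ w) :
    |tensorSum δ (indexBox k L) (cellAvg δ Φ) x - Φ x| ≤ w := by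
  have h1 := sum_tensorBump_eq_one hx
  have hw0 : 0 ≤ w := (abs_nonneg _).trans (hω x fun i => by simp; positivity)
  have hrepr : tensorSum δ (indexBox k L) (cellAvg δ Φ) x - Φ x =
      ∑ l ∈ indexBox k L, (cellAvg δ Φ l - Φ x) * tensorBump δ l x := by
    simp only [sub_mul, Finset.sum_sub_distrib, ← Finset.mul_sum, h1, mul_one, tensorSum]
  rw [hrepr]
  refine (Finset.abs_sum_le_sum_abs _ _).trans ?_
  have hcell : ∀ l : Fin k → ℤ, (∀ i, |x i / δ - l i| < 1) → |cellAvg δ Φ l - Φ x| ≤ w := by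
    intro l hl
    -- `cellAvg Φ - Φ x = δ^{-k} ∫_{Q_l} (Φ y - Φ x) dy`
    have hvol := volume_avgCell_lt_top hδ.le l
    have hΦint : IntegrableOn Φ (avgCell δ l) :=
      (hΦ.continuousOn.integrableOn_compact (isCompact_Icc)).mono_set (avgCell_subset_Icc δ l)
    have hconst : IntegrableOn (fun _ => Φ x) (avgCell δ l) := integrableOn_const hvol.ne
    have hδk : 0 < δ ^ k := pow_pos hδ k
    have hrew : cellAvg δ Φ l - Φ x = (δ ^ k)⁻¹ * ∫ y in avgCell δ l, (Φ y - Φ x) := by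
      rw [integral_sub hΦint hconst, setIntegral_const, smul_eq_mul, measureReal_avgCell hδ.le,
        cellAvg, mul_sub]
      congr 1
      field_simp
    rw [hrew, abs_mul, abs_inv, abs_of_pos hδk]
    have hbd := norm_setIntegral_le_of_norm_le_const hvol (f := fun y => Φ y - Φ x) (C := w)
      fun y hy => by
        rw [Real.norm_eq_abs]
        refine hω y fun i => ?_
        rw [mem_avgCell_iff] at hy
        obtain ⟨hy1, hy2⟩ := hy i
        have hli := hl i
        rw [abs_lt] at hli
        obtain ⟨hl1, hl2⟩ := hli
        rw [div_sub' hδ.ne', lt_div_iff₀ hδ] at hl1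
        rw [div_sub' hδ.ne', div_lt_one hδ] at hl2
        rw [abs_le]
        constructor <;> nlinarith
    rw [Real.norm_eq_abs, measureReal_avgCell hδ.le] at hbd
    calc (δ ^ k)⁻¹ * |∫ y in avgCell δ l, (Φ y - Φ x)| ≤ (δ ^ k)⁻¹ * (w * δ ^ k) :=
          mul_le_mul_of_nonneg_left hbd (inv_nonneg.2 hδk.le)
      _ = w := by field_simp
  calc ∑ l ∈ indexBox k L, |(cellAvg δ Φ l - Φ x) * tensorBump δ l x|
      ≤ ∑ l ∈ indexBox k L, w * tensorBump δ l x := Finset.sum_le_sum fun l _ => by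
        rw [abs_mul, abs_of_nonneg (tensorBump_nonneg δ l x)]
        by_cases hl : ∀ i, |x i / δ - l i| < 1
        · exact mul_le_mul_of_nonneg_right (hcell l hl) (tensorBump_nonneg δ l x)
        · push Not at hl
          obtain ⟨i, hi⟩ := hl
          rw [tensorBump_eq_zero hi, mul_zero, mul_zero]
    _ = w := by rw [← Finset.mul_sum, h1, mul_one]

end Uniform

/-! ### Row sums of cell averages and vanishing marginals -/

section Rows

variable {n : ℕ}

/-- The reduced cell of a row: `Q'_l = ∏_{j} [δ(l_{i₀.succAbove j} - 1), δ l_{i₀.succAbove j})`. [cite: Polymath8b2014, Theorem 3.14 (proof, §5.4, p. 23)] -/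
def rowCell (δ : ℝ) (i₀ : Fin (n + 1)) (l : Fin (n + 1) → ℤ) : Set (Fin n → ℝ) :=
  Set.pi Set.univ fun j => Set.Ico (δ * ((l (i₀.succAbove j) : ℝ) - 1)) (δ * (l (i₀.succAbove j) : ℝ))

/-- Reduced cells are measurable. [folklore] -/
theorem measurableSet_rowCell (δ : ℝ) (i₀ : Fin (n + 1)) (l : Fin (n + 1) → ℤ) :
    MeasurableSet (rowCell δ i₀ l) :=
  MeasurableSet.univ_pi fun _ => measurableSet_Ico

/-- Reduced cells have finite volume. [folklore] -/
theorem volume_rowCell_lt_top (δ : ℝ) (i₀ : Fin (n + 1)) (l : Fin (n + 1) → ℤ) :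
    volume (rowCell δ i₀ l) < ⊤ :=
  lt_of_le_of_lt (measure_mono (show rowCell δ i₀ l ⊆ Set.Icc
      (fun j => δ * ((l (i₀.succAbove j) : ℝ) - 1)) (fun j => δ * (l (i₀.succAbove j) : ℝ)) from
    fun _ hy => ⟨fun j => ((Set.mem_univ_pi.1 hy) j).1, fun j => ((Set.mem_univ_pi.1 hy) j).2.le⟩))
    measure_Icc_lt_top

/-- Coordinates of a point of a reduced cell. [folklore] -/
theorem mem_rowCell_iff {δ : ℝ} {i₀ : Fin (n + 1)} {l : Fin (n + 1) → ℤ} {t : Fin n → ℝ} :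
    t ∈ rowCell δ i₀ l ↔ ∀ j, δ * ((l (i₀.succAbove j) : ℝ) - 1) ≤ t j ∧
      t j < δ * (l (i₀.succAbove j) : ℝ) := by
  simp [rowCell]

/-- The cell of the row member `l[i₀ := m]` is the preimage of `[δ(m-1), δm) × Q'_l` under the
coordinate splitting. [folklore] -/
theorem avgCell_update_eq_preimage (δ : ℝ) (i₀ : Fin (n + 1)) (l : Fin (n + 1) → ℤ) (m : ℤ) :
    avgCell δ (Function.update l i₀ m) =
      splitEquiv n i₀ ⁻¹' (Set.Ico (δ * ((m : ℝ) - 1)) (δ * (m : ℝ)) ×ˢ rowCell δ i₀ l) := by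
  ext x
  simp only [avgCell, rowCell, Set.mem_univ_pi, Set.mem_preimage, Set.mem_prod, Set.mem_Ico]
  rw [Fin.forall_iff_succAbove i₀]
  simp only [Function.update_self, Function.update_of_ne (Fin.succAbove_ne i₀ _)]
  exact Iff.rfl

/-- **Fubini on one cell of a row**:
`∫_{Q_{l[i₀:=m]}} F = ∫_{t ∈ Q'_l} ∫_{u ∈ [δ(m-1), δm)} F(insertNth i₀ u t) du dt` for bounded
measurable `F`, and the inner integral is integrable in `t` on `Q'_l`. [folklore] -/
theorem setIntegral_avgCell_update {δ : ℝ} (i₀ : Fin (n + 1)) (l : Fin (n + 1) → ℤ) (m : ℤ)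
    {F : (Fin (n + 1) → ℝ) → ℝ} (hFm : Measurable F) {C : ℝ} (hC : ∀ y, |F y| ≤ C) :
    IntegrableOn (fun t : Fin n → ℝ => ∫ u in Set.Ico (δ * ((m : ℝ) - 1)) (δ * (m : ℝ)),
        F (Fin.insertNth i₀ u t)) (rowCell δ i₀ l) ∧
    ∫ y in avgCell δ (Function.update l i₀ m), F y =
      ∫ t in rowCell δ i₀ l, ∫ u in Set.Ico (δ * ((m : ℝ) - 1)) (δ * (m : ℝ)),
        F (Fin.insertNth i₀ u t) := by
  set I : Set ℝ := Set.Ico (δ * ((m : ℝ) - 1)) (δ * (m : ℝ)) with hI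
  set Q := rowCell δ i₀ l with hQ
  have hE := splitEquiv_measurePreserving (n := n) i₀
  -- the integrand on the product
  set g : ℝ × (Fin n → ℝ) → ℝ := fun p => F ((splitEquiv n i₀).symm p) with hg
  have hgm : Measurable g := hFm.comp (splitEquiv n i₀).symm.measurable
  have hgapp : ∀ u t, g (u, t) = F (Fin.insertNth i₀ u t) := fun u t => rfl
  -- integrability of `g` on `I ×ˢ Q`
  have hvol : (volume : Measure (ℝ × (Fin n → ℝ))) (I ×ˢ Q) < ⊤ := by
    rw [Measure.volume_eq_prod, Measure.prod_prod]
    exact ENNReal.mul_lt_top (by rw [hI]; exact measure_Ico_lt_top)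
      (volume_rowCell_lt_top δ i₀ l)
  have hgint : IntegrableOn g (I ×ˢ Q) (volume.prod volume) := by
    rw [← Measure.volume_eq_prod]
    refine IntegrableOn.of_bound hvol hgm.aestronglyMeasurable C (ae_of_all _ fun p => ?_)
    rw [Real.norm_eq_abs]; exact hC _
  have hgint' : Integrable g ((volume.restrict I).prod (volume.restrict Q)) := by
    rw [Measure.prod_restrict]; exact hgint
  constructor
  · have h := hgint'.integral_prod_right
    exact h
  · have h1 := hE.setIntegral_preimage_emb (splitEquiv n i₀).measurableEmbedding g (I ×ˢ Q)
    have h1' : ∫ y in avgCell δ (Function.update l i₀ m), F y =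
        ∫ p in I ×ˢ Q, g p ∂(volume.prod volume) := by
      rw [avgCell_update_eq_preimage, ← Measure.volume_eq_prod, ← h1]
      refine setIntegral_congr_fun
        ((splitEquiv n i₀).measurable (measurableSet_Ico.prod (measurableSet_rowCell δ i₀ l)))
        fun x _ => ?_
      simp only [hg, MeasurableEquiv.symm_apply_apply]
    rw [h1', ← Measure.prod_restrict, integral_prod_symm g hgint']
    rfl

/-- The cells `[δ(m-1), δm)`, `-L ≤ m ≤ L`, are pairwise disjoint. [folklore] -/
theorem pairwiseDisjoint_Ico_int {δ : ℝ} (hδ : 0 < δ) (L : ℕ) :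
    Set.Pairwise (↑(Finset.Icc (-(L : ℤ)) L) : Set ℤ)
      (fun m m' : ℤ => Disjoint (Set.Ico (δ * ((m : ℝ) - 1)) (δ * (m : ℝ)))
        (Set.Ico (δ * ((m' : ℝ) - 1)) (δ * (m' : ℝ)))) := by
  intro m _ m' _ hmm'
  rw [Set.disjoint_left]
  intro u hu hu'
  rw [Set.mem_Ico] at hu hu'
  rcases lt_or_gt_of_ne hmm' with hlt | hlt
  · have : (m : ℝ) ≤ (m' : ℝ) - 1 := by exact_mod_cast Int.le_sub_one_of_lt hlt
    nlinarith [hu.2, hu'.1]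
  · have : (m' : ℝ) ≤ (m : ℝ) - 1 := by exact_mod_cast Int.le_sub_one_of_lt hlt
    nlinarith [hu'.2, hu.1]

/-- The cells `[δ(m-1), δm)`, `-L ≤ m ≤ L`, tile `[δ(-L-1), δL)`. [folklore] -/
theorem biUnion_Ico_int {δ : ℝ} (hδ : 0 < δ) (L : ℕ) :
    (⋃ m ∈ Finset.Icc (-(L : ℤ)) L, Set.Ico (δ * ((m : ℝ) - 1)) (δ * (m : ℝ))) =
      Set.Ico (δ * (-(L : ℝ) - 1)) (δ * (L : ℝ)) := by
  ext u
  simp only [Set.mem_iUnion, Set.mem_Ico, Finset.mem_Icc, exists_prop]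
  constructor
  · rintro ⟨m, ⟨hm1, hm2⟩, hu1, hu2⟩
    have hm1' : (-(L : ℝ)) ≤ (m : ℝ) := by exact_mod_cast hm1
    have hm2' : (m : ℝ) ≤ (L : ℝ) := by exact_mod_cast hm2
    constructor <;> nlinarith
  · rintro ⟨hu1, hu2⟩
    refine ⟨⌊u / δ⌋ + 1, ⟨?_, ?_⟩, ?_, ?_⟩
    · have h : (-(L : ℤ) - 1 : ℤ) ≤ ⌊u / δ⌋ := by
        rw [Int.le_floor]
        push_cast
        rw [le_div_iff₀ hδ]
        linarith
      omega
    · have h : ⌊u / δ⌋ < (L : ℤ) := by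
        rw [Int.floor_lt]
        push_cast
        rw [div_lt_iff₀ hδ]
        linarith
      omega
    · push_cast
      have := Int.floor_le (u / δ)
      rw [le_div_iff₀ hδ] at this
      linarith
    · push_cast
      have := Int.lt_floor_add_one (u / δ)
      rw [div_lt_iff₀ hδ] at this
      linarith

/-- Along a line in the `i₀`-direction: `∫_{[δ(-L-1), δL)} f = ∫_{(0,∞)} f` when `f` vanishes off
`[0, T]` and `T < δL`. [folklore] -/
theorem setIntegral_Ico_eq_setIntegral_Ioi {δ : ℝ} (hδ : 0 < δ) {L : ℕ} {T : ℝ} (hT0 : 0 ≤ T)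
    (hT : T < δ * L) {f : ℝ → ℝ} (hf : ∀ u, f u ≠ 0 → 0 ≤ u ∧ u ≤ T) :
    ∫ u in Set.Ico (δ * (-(L : ℝ) - 1)) (δ * (L : ℝ)), f u = ∫ u in Set.Ioi 0, f u := by
  have hz : ∀ u, u < 0 ∨ T < u → f u = 0 := fun u hu => by
    by_contra hne
    have := hf u hne
    rcases hu with hu | hu <;> linarith [this.1, this.2]
  have h1 : ∫ u in Set.Ico (δ * (-(L : ℝ) - 1)) (δ * (L : ℝ)), f u = ∫ u in Set.Icc 0 T, f u := by
    refine setIntegral_eq_of_subset_of_forall_sdiff_eq_zero measurableSet_Ico ?_ ?_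
    · intro u hu
      rw [Set.mem_Icc] at hu
      rw [Set.mem_Ico]
      have : δ * (-(L : ℝ) - 1) ≤ 0 := by
        have : (0 : ℝ) ≤ L := Nat.cast_nonneg L
        nlinarith
      constructor <;> linarith [hu.1, hu.2]
    · intro u hu
      rw [Set.mem_sdiff, Set.mem_Ico, Set.mem_Icc, not_and_or, not_le, not_le] at hu
      exact hz u hu.2
  have h2 : ∫ u in Set.Ioi 0, f u = ∫ u in Set.Ioc 0 T, f u := by
    refine setIntegral_eq_of_subset_of_forall_sdiff_eq_zero measurableSet_Ioi ?_ ?_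
    · exact Set.Ioc_subset_Ioi_self
    · intro u hu
      rw [Set.mem_sdiff, Set.mem_Ioi, Set.mem_Ioc, not_and_or, not_lt, not_le] at hu
      rcases hu.2 with h | h
      · linarith [hu.1]
      · exact hz u (Or.inr h)
  rw [h1, h2, integral_Icc_eq_integral_Ioc]

/-- **Row sums of cell averages vanish on the vanishing-marginal region.**  For bounded measurable
`F` vanishing unless `0 ≤ y_{i₀} ≤ T < δL`, and a row `l` whose reduced cell `Q'_l` is such that the
`t_{i₀}`-marginal `∫₀^∞ F(insertNth i₀ u t) du` vanishes for almost every `t ∈ Q'_l`,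
`Σ_{-L ≤ m ≤ L} cellAvg δ F (l[i₀ := m]) = 0` ("from the vanishing marginal condition we see that we
also have `f₃ = 0`" on the corresponding region, p. 23). [cite: Polymath8b2014, Theorem 3.14 (proof, §5.4, p. 23)] -/
theorem sum_cellAvg_row_eq_zero {δ : ℝ} (hδ : 0 < δ) (L : ℕ) (i₀ : Fin (n + 1))
    {F : (Fin (n + 1) → ℝ) → ℝ} (hFm : Measurable F) {C : ℝ} (hC : ∀ y, |F y| ≤ C)
    {T : ℝ} (hT0 : 0 ≤ T) (hT : T < δ * L) (hFsupp : ∀ y, F y ≠ 0 → 0 ≤ y i₀ ∧ y i₀ ≤ T)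
    (l : Fin (n + 1) → ℤ)
    (hmarg : ∀ᵐ t : Fin n → ℝ, t ∈ rowCell δ i₀ l → ∫ u in Set.Ioi 0, F (Fin.insertNth i₀ u t) = 0) :
    ∑ m ∈ Finset.Icc (-(L : ℤ)) L, cellAvg δ F (Function.update l i₀ m) = 0 := by
  have hk : ∀ m : ℤ, cellAvg δ F (Function.update l i₀ m) =
      (δ ^ (n + 1))⁻¹ * ∫ t in rowCell δ i₀ l, ∫ u in Set.Ico (δ * ((m : ℝ) - 1)) (δ * (m : ℝ)),
        F (Fin.insertNth i₀ u t) := fun m => by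
    rw [cellAvg, (setIntegral_avgCell_update i₀ l m hFm hC).2]
  simp_rw [hk]
  rw [← Finset.mul_sum, ← integral_finsetSum _ fun m _ => (setIntegral_avgCell_update i₀ l m hFm hC).1]
  rw [setIntegral_eq_zero_of_ae_eq_zero, mul_zero]
  filter_upwards [hmarg] with t ht htQ
  -- the line `u ↦ F(insertNth i₀ u t)`
  set f : ℝ → ℝ := fun u => F (Fin.insertNth i₀ u t) with hf
  have hfm : Measurable f := hFm.comp (by
    show Measurable fun u : ℝ => Fin.insertNth (α := fun _ => ℝ) i₀ u t
    exact (splitEquiv n i₀).symm.measurable.comp (measurable_id.prodMk measurable_const))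
  have hfint : ∀ a b : ℝ, IntegrableOn f (Set.Ico a b) := fun a b =>
    IntegrableOn.of_bound measure_Ico_lt_top hfm.aestronglyMeasurable C
      (ae_of_all _ fun u => by rw [Real.norm_eq_abs]; exact hC _)
  have hfsupp : ∀ u, f u ≠ 0 → 0 ≤ u ∧ u ≤ T := fun u hu => by
    have := hFsupp _ hu
    simpa [Fin.insertNth_apply_same] using this
  show ∑ m ∈ Finset.Icc (-(L : ℤ)) L, ∫ u in Set.Ico (δ * ((m : ℝ) - 1)) (δ * (m : ℝ)), f u = 0
  rw [← integral_biUnion_finset _ (fun m _ => measurableSet_Ico) (pairwiseDisjoint_Ico_int hδ L)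
    (fun m _ => hfint _ _), biUnion_Ico_int hδ L, setIntegral_Ico_eq_setIntegral_Ioi hδ hT0 hT hfsupp]
  exact ht htQ

end Rows

end Literature.NumberTheory.Sieve
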